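import Summits.Ventures.LatticeQCDFlow.Scaling.OneSidedHubFloor
import Summits.Ventures.LatticeQCDFlow.Scaling.HubModeTransport
import Summits.Ventures.LatticeQCDFlow.Scaling.FlowSamplerTunnelingTime
import Summits.Ventures.LatticeQCDFlow.Scaling.ReplicaExchangeModeMixingTime

/-!
HONEST FRAMING: exact (Metropolis-corrected) sampling algorithms for lattice gauge theory; figures
of merit are autocorrelation/cost numbers at stated couplings and volumes; no continuum-physics
claim.

# OneSidedHubCorollaries — THE ONE-SIDED LINEAR LAW IN THE OTHER CURRENCIES: SECTOR-REWEIGHTED TRANSPORTS HAVE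
# REWEIGHTING FACTORS = SECTOR-WEIGHT RATIOS (`r_k(j)·μ_0(A_j) = μ_{k+1}(A_j)`), SO THE HYPOTHESIS `p·r_k ≤ 1` OF
# `Scaling/OneSidedHubFloor` IS EXACTLY ONE-SIDED SECTOR PERSISTENCE; FROM EQUILIBRIUM EVERY COLD REPLICA ENTERS
# SECTOR `A` WITHIN `14K(1 − μ_k(A))/(p·min{t, γ₀(1−t)}·μ_k(A))` STEPS; `t_mix(lazy; ε) ≤ ⌈(28K/(p·min{t,γ₀(1−t)}))·
# (½log(1/m^{K+1}) + log(1/(2ε)))⌉` (lean-2 GEN-22, ours)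

Venture-side (OURS).  Cell `lqcd-flow` (pub-lqcd), unit `pub-lqcd-lean-2-g22`, 2026-08-26.  Chapter J, file 9:
corollaries of `Scaling/OneSidedHubFloor` (J8: hot-only map-assisted star with sector-reweighted transports
`μ_{k+1}(φ_k u) = r_k(mode u)·μ_0(u)`, `p·r_k ≤ 1`: `Gap ≥ p·min{t, γ₀(1−t)}/(14K)`).  §1 identifies the reweighting
factors with the sector-weight ratios (summing over a sector, which a sector-preserving bijection permutes), so that
J8's hypothesis reads as the one-sided sector persistence `p·μ_{k+1}(A_j) ≤ μ_0(A_j)` of `Scaling/HubModeGap` (J3);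
§2–§3 restate the floor as an equilibrium tunnelling time (`Scaling/FlowSamplerTunnelingTime`) and a lazy mixing time
(`Scaling/SimulatedTemperingMixingTime.mixingTime_lazyVersion_le_of_gap`), for the plain one-sided hot-only star
(`p·μ_{k+1} ≤ μ_0` pointwise) as well.

## What is proved

* §1 **`reweight_mul_blockMass`** (`r_k(j)·μ_0(A_j) = μ_{k+1}(A_j)`); **`flowStarReweighted_spectralGap_ge_of_persistence`**
  — sector-reweighted transports + one-sided sector persistence `p·μ_{k+1}(A_j) ≤ μ_0(A_j)` ⇒
  `Gap ≥ p·min{t, γ₀(1−t)}/(14K)`.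
* §2 `oneSidedHotOnlyStar_spectralGap_ge_linear` (the floor alone), **`oneSidedHotOnlyStar_tunnelingTime_le`**,
  **`flowStarReweighted_tunnelingTime_le`** —
  `Σ_x π̃(x)E_x(τ_{x_k∈A} ∧ N) ≤ (1 − μ_k(A))/(c·μ_k(A))`, `c = p·min{t, γ₀(1−t)}/(14K)`.
* §3 **`oneSidedHotOnlyStar_mixingTime_le`**, **`flowStarReweighted_mixingTime_le`** (hot update irreducible) —
  `t_mix(lazy P; ε) ≤ ⌈(2/c)(½log(1/m^{K+1}) + log(1/(2ε)))⌉` for `μ_k ≥ m` pointwise, `0 < ε ≤ ½`.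

NOT CLAIMED: worst-start tunnelling; non-lazy mixing; anything measured.  Literature grade (cell rule): ELEMENTARY
COROLLARIES; nothing cited as a fact; no new bib keys.
-/

noncomputable section

open Finset Function
open Literature.Probability.MarkovChains
open Literature.Probability.MarkovChains.Decomposition

namespace Summit.Ventures.LatticeQCDFlow.Scaling

section OneSidedCorollaries

variable {S J : Type*} [Fintype S] [DecidableEq S] [DecidableEq J] {K : ℕ} {μ : Fin (K + 1) → S → ℝ}
  {M : Fin (K + 1) → S → S → ℝ} {t : ℝ} {mode : S → J} (φ : Fin K → Equiv.Perm S)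

/-! ## §1 Reweighting factors are sector-weight ratios -/

omit [DecidableEq S] in
/-- **`r_k(j)·μ_0(A_j) = μ_{k+1}(A_j)`:** for a sector-preserving bijection `φ_k` and a sector-reweighted transport
`μ_{k+1}(φ_k u) = r_k(mode u)·μ_0(u)`, summing over the sector `A_j` (which `φ_k` permutes) identifies the reweighting
factor with the sector-weight ratio. [ours] -/
theorem reweight_mul_blockMass (hφmode : ∀ (k : Fin K) (u : S), mode (φ k u) = mode u) (r : Fin K → J → ℝ)
    (hrew : ∀ (k : Fin K) (u : S), μ k.succ (φ k u) = r k (mode u) * μ 0 u) (k : Fin K) (j : J) :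
    r k j * blockMass (μ 0) mode j = blockMass (μ k.succ) mode j := by
  unfold blockMass
  rw [← sum_block_relabel (φ k) (hφmode k) j (μ k.succ), mul_sum]
  refine sum_congr rfl fun u hu => ?_
  rw [hrew k u, mem_block.mp hu]

/-- **SECTOR-REWEIGHTED TRANSPORTS + ONE-SIDED SECTOR PERSISTENCE ⇒ THE LINEAR LAW:** hot-only updates, hot Poincaré
constant `γ₀`, `μ_{k+1}(φ_k u) = r_k(mode u)·μ_0(u)` with `φ_k` sector-preserving, and `p·μ_{k+1}(A_j) ≤ μ_0(A_j)` for
every sector and cold level: `Gap(P^φ) ≥ p·min{t, γ₀(1−t)}/(14K)`. [ours] -/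
theorem flowStarReweighted_spectralGap_ge_of_persistence [Nontrivial S]
    (hφmode : ∀ (k : Fin K) (u : S), mode (φ k u) = mode u) (hmode : Function.Surjective mode) (r : Fin K → J → ℝ)
    (hK : 1 ≤ K) (hμ : ∀ k x, 0 < μ k x) (hμ1 : ∀ k, ∑ u, μ k u = 1) (hM : ∀ k, IsRowStochastic (M k))
    (hMrev : ∀ k, DetailedBalance (μ k) (M k)) (ht0 : 0 < t) (ht1 : t < 1) {p γ₀ : ℝ} (hp : 0 < p) (hp1 : p ≤ 1)
    (hγ₀ : 0 < γ₀) (hrew : ∀ (k : Fin K) (u : S), μ k.succ (φ k u) = r k (mode u) * μ 0 u)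
    (hpers : ∀ (k : Fin K) (j : J), p * blockMass (μ k.succ) mode j ≤ blockMass (μ 0) mode j)
    (hgap0 : ∀ h : S → ℝ, γ₀ * lawVariance (μ 0) h ≤ dirichletForm (μ 0) (M 0) h) :
    p * min t (γ₀ * (1 - t)) / (14 * K)
      ≤ spectralGap (tensorFun μ) (fun x y : Fin (K + 1) → S =>
          t * ptGraphSwap μ (fun k : Fin K => ((0 : Fin (K + 1)), k.succ)) φ x y
            + (1 - t) * prodKernel (fun k : Fin (K + 1) => if k = 0 then (1 : ℝ) else 0) M x y) := by
  refine flowStarReweighted_spectralGap_ge_linear φ r hK hμ hμ1 hM hMrev ht0 ht1 hp hp1 hγ₀ hrew (fun k j => ?_) hgap0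
  have hν0 : 0 < blockMass (μ 0) mode j := blockMass_pos (hμ 0) hmode j
  have h := hpers k j
  rw [← reweight_mul_blockMass φ hφmode r hrew k j] at h
  -- `p·(r·ν_0(j)) ≤ ν_0(j)` with `ν_0(j) > 0`
  by_contra hc
  push Not at hc
  have : blockMass (μ 0) mode j < p * r k j * blockMass (μ 0) mode j := by
    calc blockMass (μ 0) mode j = 1 * blockMass (μ 0) mode j := (one_mul _).symm
      _ < p * r k j * blockMass (μ 0) mode j := mul_lt_mul_of_pos_right hc hν0
  linarith

/-! ## §2 Tunnelling times -/

/-- **The one-sided linear floor of the hot-only star (identity maps), stated alone:**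
`Gap ≥ p·min{t, γ₀(1−t)}/(14K)` under `p·μ_{k+1} ≤ μ_0` (the floor half of
`Scaling/OneSidedHubFloor.oneSidedHotOnlyStar_spectralGap_two_sided`). [ours] -/
theorem oneSidedHotOnlyStar_spectralGap_ge_linear [Nontrivial S] (hK : 1 ≤ K) (hμ : ∀ k x, 0 < μ k x)
    (hμ1 : ∀ k, ∑ u, μ k u = 1) (hM : ∀ k, IsRowStochastic (M k)) (hMrev : ∀ k, DetailedBalance (μ k) (M k))
    (ht0 : 0 < t) (ht1 : t < 1) {p γ₀ : ℝ} (hp : 0 < p) (hp1 : p ≤ 1) (hγ₀ : 0 < γ₀)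
    (hdom : ∀ (k : Fin K) (u : S), p * μ k.succ u ≤ μ 0 u)
    (hgap0 : ∀ h : S → ℝ, γ₀ * lawVariance (μ 0) h ≤ dirichletForm (μ 0) (M 0) h) :
    p * min t (γ₀ * (1 - t)) / (14 * K)
      ≤ spectralGap (tensorFun μ) (fun x y : Fin (K + 1) → S =>
          t * ptGraphSwap μ (fun k : Fin K => ((0 : Fin (K + 1)), k.succ)) (fun _ : Fin K => Equiv.refl S) x y
            + (1 - t) * prodKernel (fun k : Fin (K + 1) => if k = 0 then (1 : ℝ) else 0) M x y) := by
  have hKpos : (0 : ℝ) < K := Nat.cast_pos.mpr (by omega)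
  have hw0 : ∀ k : Fin (K + 1), 0 ≤ (if k = 0 then (1 : ℝ) else 0) := fun k => by positivity
  have h := oneSidedHub_spectralGap_ge (e := fun k : Fin K => ((0 : Fin (K + 1)), k.succ))
    (w := fun k : Fin (K + 1) => if k = 0 then (1 : ℝ) else 0) hK hK (fun k => (Fin.succ_ne_zero k).symm)
    (fun k => ⟨k, rfl⟩) hμ hμ1 hM hMrev hw0 hotOnlyWeight_sum (by simp) ht0 ht1 hp hp1 hγ₀ hdom hgap0
  simp only [if_true, mul_one] at h
  refine le_trans ?_ h
  rw [show p * min t (γ₀ * (1 - t)) / (14 * K) = p * (min t (γ₀ * (1 - t)) / (14 * K)) by ring]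
  refine mul_le_mul_of_nonneg_left (le_min ?_ ?_) hp.le
  · calc min t (γ₀ * (1 - t)) / (14 * K) ≤ t / (14 * K) := div_le_div_of_nonneg_right (min_le_left _ _) (by positivity)
      _ ≤ t / (6 * K) := div_le_div_of_nonneg_left ht0.le (by positivity) (by nlinarith)
  · exact div_le_div_of_nonneg_right (min_le_right _ _) (by positivity)

/-- **ONE-SIDED HOT-ONLY STAR, TUNNELLING:** `p·μ_{k+1} ≤ μ_0` pointwise, hot Poincaré constant `γ₀`, `μ_k(A) > 0`:
from equilibrium replica `k` enters `A` within `(1 − μ_k(A))/((p·min{t,γ₀(1−t)}/(14K))·μ_k(A))` expected steps.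
[ours] -/
theorem oneSidedHotOnlyStar_tunnelingTime_le [Nontrivial S] (hK : 1 ≤ K) (hμ : ∀ k x, 0 < μ k x)
    (hμ1 : ∀ k, ∑ u, μ k u = 1) (hM : ∀ k, IsRowStochastic (M k)) (hMrev : ∀ k, DetailedBalance (μ k) (M k))
    (ht0 : 0 < t) (ht1 : t < 1) {p γ₀ : ℝ} (hp : 0 < p) (hp1 : p ≤ 1) (hγ₀ : 0 < γ₀)
    (hdom : ∀ (k : Fin K) (u : S), p * μ k.succ u ≤ μ 0 u)
    (hgap0 : ∀ h : S → ℝ, γ₀ * lawVariance (μ 0) h ≤ dirichletForm (μ 0) (M 0) h) (k : Fin (K + 1)) {A : Finset S}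
    (hA : 0 < ∑ u ∈ A, μ k u) (N : ℕ) :
    ∑ x, tensorFun μ x * meanHitWithin (fun x y : Fin (K + 1) → S =>
          t * ptGraphSwap μ (fun k : Fin K => ((0 : Fin (K + 1)), k.succ)) (fun _ : Fin K => Equiv.refl S) x y
            + (1 - t) * prodKernel (fun k : Fin (K + 1) => if k = 0 then (1 : ℝ) else 0) M x y)
        (↑(univ.filter (fun x : Fin (K + 1) → S => x k ∈ A)) : Set (Fin (K + 1) → S)) N x
      ≤ (1 - ∑ u ∈ A, μ k u) / (p * min t (γ₀ * (1 - t)) / (14 * K) * ∑ u ∈ A, μ k u) := by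
  have hKpos : (0 : ℝ) < K := Nat.cast_pos.mpr (by omega)
  have hw0 : ∀ k : Fin (K + 1), 0 ≤ (if k = 0 then (1 : ℝ) else 0) := fun k => by positivity
  exact tunnelingTime_le_of_gapFloor hμ hμ1
    (weightedScheme_isRowStochastic (ptGraphSwap_isRowStochastic hμ) hM hw0 hotOnlyWeight_sum ht0.le ht1.le)
    (weightedScheme_detailedBalance (ptGraphSwap_detailedBalance hμ) hMrev t)
    (div_pos (mul_pos hp (lt_min ht0 (mul_pos hγ₀ (by linarith)))) (by positivity))
    (oneSidedHotOnlyStar_spectralGap_ge_linear hK hμ hμ1 hM hMrev ht0 ht1 hp hp1 hγ₀ hdom hgap0) k hA N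

omit [DecidableEq J] in
/-- **SECTOR-REWEIGHTED TRANSPORTS, TUNNELLING:** `μ_{k+1}(φ_k u) = r_k(mode u)·μ_0(u)`, `p·r_k ≤ 1`, hot-only updates:
from equilibrium replica `k` enters `A` within `(1 − μ_k(A))/((p·min{t,γ₀(1−t)}/(14K))·μ_k(A))` expected steps.
[ours] -/
theorem flowStarReweighted_tunnelingTime_le [Nontrivial S] (r : Fin K → J → ℝ) (hK : 1 ≤ K)
    (hμ : ∀ k x, 0 < μ k x) (hμ1 : ∀ k, ∑ u, μ k u = 1) (hM : ∀ k, IsRowStochastic (M k))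
    (hMrev : ∀ k, DetailedBalance (μ k) (M k)) (ht0 : 0 < t) (ht1 : t < 1) {p γ₀ : ℝ} (hp : 0 < p) (hp1 : p ≤ 1)
    (hγ₀ : 0 < γ₀) (hrew : ∀ (k : Fin K) (u : S), μ k.succ (φ k u) = r k (mode u) * μ 0 u)
    (hr : ∀ (k : Fin K) (j : J), p * r k j ≤ 1)
    (hgap0 : ∀ h : S → ℝ, γ₀ * lawVariance (μ 0) h ≤ dirichletForm (μ 0) (M 0) h) (k : Fin (K + 1)) {A : Finset S}
    (hA : 0 < ∑ u ∈ A, μ k u) (N : ℕ) :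
    ∑ x, tensorFun μ x * meanHitWithin (fun x y : Fin (K + 1) → S =>
          t * ptGraphSwap μ (fun k : Fin K => ((0 : Fin (K + 1)), k.succ)) φ x y
            + (1 - t) * prodKernel (fun k : Fin (K + 1) => if k = 0 then (1 : ℝ) else 0) M x y)
        (↑(univ.filter (fun x : Fin (K + 1) → S => x k ∈ A)) : Set (Fin (K + 1) → S)) N x
      ≤ (1 - ∑ u ∈ A, μ k u) / (p * min t (γ₀ * (1 - t)) / (14 * K) * ∑ u ∈ A, μ k u) := by
  have hKpos : (0 : ℝ) < K := Nat.cast_pos.mpr (by omega)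
  have hw0 : ∀ k : Fin (K + 1), 0 ≤ (if k = 0 then (1 : ℝ) else 0) := fun k => by positivity
  exact tunnelingTime_le_of_gapFloor hμ hμ1
    (weightedScheme_isRowStochastic (ptGraphSwap_isRowStochastic hμ) hM hw0 hotOnlyWeight_sum ht0.le ht1.le)
    (weightedScheme_detailedBalance (ptGraphSwap_detailedBalance hμ) hMrev t)
    (div_pos (mul_pos hp (lt_min ht0 (mul_pos hγ₀ (by linarith)))) (by positivity))
    (flowStarReweighted_spectralGap_ge_linear φ r hK hμ hμ1 hM hMrev ht0 ht1 hp hp1 hγ₀ hrew hr hgap0) k hA N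

/-! ## §3 Lazy mixing times -/

/-- **ONE-SIDED HOT-ONLY STAR, MIXING:** hot update irreducible with Poincaré constant `γ₀`, `p·μ_{k+1} ≤ μ_0`,
`μ_k ≥ m > 0` pointwise, `0 < ε ≤ ½`:
`t_mix(lazy P; ε) ≤ ⌈(2/c)(½log(1/m^{K+1}) + log(1/(2ε)))⌉`, `c = p·min{t,γ₀(1−t)}/(14K)`. [ours] -/
theorem oneSidedHotOnlyStar_mixingTime_le [Nontrivial S] (hK : 1 ≤ K) (hμ : ∀ k x, 0 < μ k x)
    (hμ1 : ∀ k, ∑ u, μ k u = 1) (hM : ∀ k, IsRowStochastic (M k)) (hMrev : ∀ k, DetailedBalance (μ k) (M k))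
    (hM0 : IsIrreducible (M 0)) (ht0 : 0 < t) (ht1 : t < 1) {p γ₀ : ℝ} (hp : 0 < p) (hp1 : p ≤ 1) (hγ₀ : 0 < γ₀)
    (hdom : ∀ (k : Fin K) (u : S), p * μ k.succ u ≤ μ 0 u)
    (hgap0 : ∀ h : S → ℝ, γ₀ * lawVariance (μ 0) h ≤ dirichletForm (μ 0) (M 0) h)
    {m : ℝ} (hm0 : 0 < m) (hm : ∀ k x, m ≤ μ k x) {ε : ℝ} (hε : 0 < ε) (hε2 : ε ≤ 1 / 2) :
    mixingTime (lazyVersion (fun x y : Fin (K + 1) → S =>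
          t * ptGraphSwap μ (fun k : Fin K => ((0 : Fin (K + 1)), k.succ)) (fun _ : Fin K => Equiv.refl S) x y
            + (1 - t) * prodKernel (fun k : Fin (K + 1) => if k = 0 then (1 : ℝ) else 0) M x y)) (tensorFun μ) ε
      ≤ ⌈2 / (p * min t (γ₀ * (1 - t)) / (14 * K))
          * (Real.log (1 / m ^ (K + 1)) / 2 + Real.log (1 / (2 * ε)))⌉₊ := by
  have hKpos : (0 : ℝ) < K := Nat.cast_pos.mpr (by omega)
  have hw0 : ∀ k : Fin (K + 1), 0 ≤ (if k = 0 then (1 : ℝ) else 0) := fun k => by positivity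
  have hc : 0 < p * min t (γ₀ * (1 - t)) / (14 * K) :=
    div_pos (mul_pos hp (lt_min ht0 (mul_pos hγ₀ (by linarith)))) (by positivity)
  exact mixingTime_lazyVersion_le_of_gap (tensorFun_pos hμ) (sum_tensorFun_eq_one μ hμ1)
    (weightedScheme_isRowStochastic (ptGraphSwap_isRowStochastic hμ) hM hw0 hotOnlyWeight_sum ht0.le ht1.le)
    (weightedScheme_detailedBalance (ptGraphSwap_detailedBalance hμ) hMrev t)
    (weightedStar_isIrreducible_of_hot hμ hM hM0 hw0 hotOnlyWeight_sum (by simp) ht0 ht1) hc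
    (oneSidedHotOnlyStar_spectralGap_ge_linear hK hμ hμ1 hM hMrev ht0 ht1 hp hp1 hγ₀ hdom hgap0)
    (πmin := m ^ (K + 1)) (by positivity) (tensorFun_ge_pow hm0.le hm) hε hε2

omit [DecidableEq J] in
/-- **SECTOR-REWEIGHTED TRANSPORTS, MIXING:** hot update irreducible with Poincaré constant `γ₀`, hot-only updates,
`μ_{k+1}(φ_k u) = r_k(mode u)·μ_0(u)` with `p·r_k ≤ 1`, `μ_k ≥ m > 0`, `0 < ε ≤ ½`:
`t_mix(lazy P^φ; ε) ≤ ⌈(2/c)(½log(1/m^{K+1}) + log(1/(2ε)))⌉`, `c = p·min{t,γ₀(1−t)}/(14K)`. [ours] -/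
theorem flowStarReweighted_mixingTime_le [Nontrivial S] (r : Fin K → J → ℝ) (hK : 1 ≤ K)
    (hμ : ∀ k x, 0 < μ k x) (hμ1 : ∀ k, ∑ u, μ k u = 1) (hM : ∀ k, IsRowStochastic (M k))
    (hMrev : ∀ k, DetailedBalance (μ k) (M k)) (hM0 : IsIrreducible (M 0)) (ht0 : 0 < t) (ht1 : t < 1)
    {p γ₀ : ℝ} (hp : 0 < p) (hp1 : p ≤ 1) (hγ₀ : 0 < γ₀)
    (hrew : ∀ (k : Fin K) (u : S), μ k.succ (φ k u) = r k (mode u) * μ 0 u) (hr : ∀ (k : Fin K) (j : J), p * r k j ≤ 1)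
    (hgap0 : ∀ h : S → ℝ, γ₀ * lawVariance (μ 0) h ≤ dirichletForm (μ 0) (M 0) h)
    {m : ℝ} (hm0 : 0 < m) (hm : ∀ k x, m ≤ μ k x) {ε : ℝ} (hε : 0 < ε) (hε2 : ε ≤ 1 / 2) :
    mixingTime (lazyVersion (fun x y : Fin (K + 1) → S =>
          t * ptGraphSwap μ (fun k : Fin K => ((0 : Fin (K + 1)), k.succ)) φ x y
            + (1 - t) * prodKernel (fun k : Fin (K + 1) => if k = 0 then (1 : ℝ) else 0) M x y)) (tensorFun μ) ε
      ≤ ⌈2 / (p * min t (γ₀ * (1 - t)) / (14 * K))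
          * (Real.log (1 / m ^ (K + 1)) / 2 + Real.log (1 / (2 * ε)))⌉₊ := by
  have hKpos : (0 : ℝ) < K := Nat.cast_pos.mpr (by omega)
  have hw0 : ∀ k : Fin (K + 1), 0 ≤ (if k = 0 then (1 : ℝ) else 0) := fun k => by positivity
  have hc : 0 < p * min t (γ₀ * (1 - t)) / (14 * K) :=
    div_pos (mul_pos hp (lt_min ht0 (mul_pos hγ₀ (by linarith)))) (by positivity)
  exact mixingTime_lazyVersion_le_of_gap (tensorFun_pos hμ) (sum_tensorFun_eq_one μ hμ1)
    (weightedScheme_isRowStochastic (ptGraphSwap_isRowStochastic hμ) hM hw0 hotOnlyWeight_sum ht0.le ht1.le)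
    (weightedScheme_detailedBalance (ptGraphSwap_detailedBalance hμ) hMrev t)
    (flowStar_isIrreducible_of_hot φ hμ hM hM0 hw0 hotOnlyWeight_sum (by simp) ht0 ht1) hc
    (flowStarReweighted_spectralGap_ge_linear φ r hK hμ hμ1 hM hMrev ht0 ht1 hp hp1 hγ₀ hrew hr hgap0)
    (πmin := m ^ (K + 1)) (by positivity) (tensorFun_ge_pow hm0.le hm) hε hε2

end OneSidedCorollaries

end Summit.Ventures.LatticeQCDFlow.Scaling

end
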